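import Literature.AlgebraicGeometry.Resolution.SncStrata
import Literature.AlgebraicGeometry.Resolution.GenericPointStalkData
import Literature.AlgebraicGeometry.Resolution.HilbertSamuelRegularCentreEquality
import Literature.AlgebraicGeometry.Resolution.HilbertSamuelLocal
import Literature.AlgebraicGeometry.Resolution.StalkSpecializesLocalization
import Literature.AlgebraicGeometry.CossartJannsenSaito2020.KeyTheoremsIsolated
import HarnessLib

/-!
# [OURS · L1 W4.2] ISOLATION IN THE HILBERT–SAMUEL LOCUS, READ ON THE STALK: at a point isolated in the HS-max locus, no proper
# generization with regular closure has `H^{(dim 𝒪/Q)}(𝒪_Q) = H^{(0)}(𝒪)` (the stalk-level hypothesis of the CP-frame kernel slice)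

Crux chain w42 (`SigmaMaxModifications`, stmt-ResolutionOfSingularities-18506; conjunct `SigmaMaxModificationsCorridor3`, stmt-…-19249),
line `w_ladder`, registered stubs `stub_isoInsepTower` / `stub_isoSepRecurrent`. Lead res-L1-w42-lead-1 (gen 5). Helper file
`--supports stmt-ResolutionOfSingularities-19249`; kernel only (no definition, no named fact). Consumer step (b) of
`…Corridor3WLadderIsoKernelCPSlice` / `…IsoKernelCPFrame` (p547474): the ring-side «HS-isolated among generizations» hypothesis of
`IdeasL1C5.false_of_hsIsolated_singular_pointTower_of_CP` FOLLOWS from the scheme-side `IsIsolatedInHSMaxLocus` clause of `IsIsoPointTower`.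

WHAT IS PROVED (`hsIsolated_stalk_of_isIsolatedInHSMaxLocus`). `X` locally Noetherian, `x ∈ X` ISOLATED in the Hilbert–Samuel-maximal locus
(`IsIsolatedInHSMaxLocus X N x`: some open `U` with `U ∩ X_max = {x}`), `𝒪_{X,x}` catenary (excellent schemes) and `ψ_X(x) ≤ N`. Then for every
prime `Q ≠ 𝔪` of `𝒪_{X,x}` with `𝒪_{X,x}/Q` regular of dimension `r`: `H^{(r)}((𝒪_{X,x})_Q) ≠ H^{(0)}(𝒪_{X,x})`. Proof: `Q` is the prime of a
generization `y ⤳ x` (`fromSpecStalk_specializes`, `primeOfSpecializes_fromSpecStalk`) with `𝒪_{X,y} = (𝒪_{X,x})_Q`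
(`isLocalizationAtPrime_stalkSpecializes`); equality of the Hilbert functions is `H_X(y) = H_X(x)` (CJS Thm. 3.3 / Lemma 3.4 reading,
`Scheme.hsFun_eq_iff_of_specializes_of_isRegularLocalRing`), so `y ∈ X_max`, `y ∈ U` (opens are stable under generization), `y = x`, `Q = 𝔪`.

HONEST FRAMING. OURS bookkeeping over the tree's HS dictionary; nothing here is a statement of H. Hironaka's manuscript [Hironaka2017] nor of
[CossartJannsenSaito2020] (pointer: Thm. 3.3, Def. 6.38). AI-written; AI review is weaker than expert review.

References: V. Cossart, U. Jannsen, S. Saito, LNM 2270 (2020), Thm. 3.3, Lemma 3.4, Def. 6.38 [CossartJannsenSaito2020]; The Stacks Project,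
Tag 01J7 [StacksProject].
-/

noncomputable section

set_option linter.dupNamespace false

open IsLocalRing AlgebraicGeometry CategoryTheory
open Literature.AlgebraicGeometry.Resolution Literature.AlgebraicGeometry.CossartJannsenSaito2020 Literature.RingTheory.HilbertSamuel

namespace Summit.ResolutionOfSingularities.ResolutionOfSingularities.Cruxes.SigmaMaxModifications.IdeasL1C5

universe u

variable {X : Scheme.{u}} [IsLocallyNoetherian X]

omit [IsLocallyNoetherian X] in
/-- Membership in the Hilbert–Samuel-maximal locus depends only on the value of the Hilbert–Samuel function. [cite: CossartJannsenSaito2020, Def. 2.34] -/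
theorem mem_hsMaxLocus_of_hsFun_eq {N : ℕ} {x y : X} (hx : x ∈ Scheme.hsMaxLocus X N)
    (h : Scheme.hsFun X N y = Scheme.hsFun X N x) : y ∈ Scheme.hsMaxLocus X N := by
  change Maximal (· ∈ Scheme.hsValues X N) (Scheme.hsFun X N y)
  rw [h]
  exact hx

omit [IsLocallyNoetherian X] in
/-- The prime of a generization EQUAL to the point is the maximal ideal. [folklore] -/
theorem primeOfSpecializes_eq_maximalIdeal_of_eq {x y : X} (h : y ⤳ x) (hyx : y = x) :
    primeOfSpecializes h = maximalIdeal (X.presheaf.stalk x) := by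
  subst hyx
  exact primeOfSpecializes_refl y

/-- **ISOLATION IN THE HS-MAX LOCUS, ON THE STALK.** At a point `x` isolated in `X_max` (`IsIsolatedInHSMaxLocus X N x`), with `𝒪_{X,x}` catenary and
`ψ_X(x) ≤ N`: for every prime `Q ≠ 𝔪` of `𝒪_{X,x}` with regular quotient of dimension `r`, `H^{(r)}((𝒪_{X,x})_Q) ≠ H^{(0)}(𝒪_{X,x})` — the
generization `y` of `x` with prime `Q` would have `H_X(y) = H_X(x)` (CJS Thm. 3.3 / Lemma 3.4), hence lie in `X_max` and in every neighbourhood of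
`x`. [cite: CossartJannsenSaito2020, Thm. 3.3, Lemma 3.4, Def. 6.38] [cite: StacksProject, Tag 01J7] -/
theorem hsIsolated_stalk_of_isIsolatedInHSMaxLocus (N : ℕ) (x : X) (hiso : IsIsolatedInHSMaxLocus X N x)
    (hcat : IsCatenaryRing (X.presheaf.stalk x)) (hN : Scheme.hsPsi X x ≤ N)
    (Q : Ideal (X.presheaf.stalk x)) [hQ : Q.IsPrime] (hne : Q ≠ maximalIdeal (X.presheaf.stalk x))
    [IsRegularLocalRing (X.presheaf.stalk x ⧸ Q)] (r : ℕ) (hr : ringKrullDim (X.presheaf.stalk x ⧸ Q) = r) :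
    hilbertSamuelFun (Localization.AtPrime Q) r ≠ hilbertFun (X.presheaf.stalk x) := by
  intro heq
  obtain ⟨U, hU, hUx⟩ := hiso
  have hx : x ∈ Scheme.hsMaxLocus X N := by
    have : x ∈ U ∩ Scheme.hsMaxLocus X N := by rw [hUx]; exact Set.mem_singleton x
    exact this.2
  have hxU : x ∈ U := by
    have : x ∈ U ∩ Scheme.hsMaxLocus X N := by rw [hUx]; exact Set.mem_singleton x
    exact this.1
  -- the generization `y` of `x` with prime `Q`
  let q : Spec (X.presheaf.stalk x) := (⟨Q, hQ⟩ : PrimeSpectrum (X.presheaf.stalk x))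
  let y : X := X.fromSpecStalk x q
  have hyx : y ⤳ x := fromSpecStalk_specializes q
  have hQy : primeOfSpecializes hyx = Q := primeOfSpecializes_fromSpecStalk q
  -- `𝒪_{X,y} = (𝒪_{X,x})_Q`
  letI := (X.presheaf.stalkSpecializes hyx).hom.toAlgebra
  haveI hlocP : IsLocalization.AtPrime (X.presheaf.stalk y) (primeOfSpecializes hyx) := isLocalizationAtPrime_stalkSpecializes hyx
  have hPC : Q.primeCompl = (primeOfSpecializes hyx).primeCompl :=
    Submonoid.ext fun a => by rw [Ideal.mem_primeCompl_iff, Ideal.mem_primeCompl_iff, hQy]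
  haveI : IsLocalization.AtPrime (X.presheaf.stalk y) Q := by
    show IsLocalization Q.primeCompl (X.presheaf.stalk y)
    rw [hPC]
    exact hlocP
  have hHS : hilbertSamuelFun (X.presheaf.stalk y) r = hilbertSamuelFun (Localization.AtPrime Q) r :=
    (hilbertSamuelFun_eq_of_ringEquiv
      (IsLocalization.algEquiv Q.primeCompl (Localization.AtPrime Q) (X.presheaf.stalk y)).toRingEquiv r).symm
  -- the quotient by `𝔭_y` is the quotient by `Q`
  haveI : IsRegularLocalRing (X.presheaf.stalk x ⧸ primeOfSpecializes hyx) :=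
    IsRegularLocalRing.of_ringEquiv (Ideal.quotEquivOfEq hQy.symm)
  have hc : ringKrullDim (X.presheaf.stalk x ⧸ primeOfSpecializes hyx) = r := by
    rw [← ringKrullDim_eq_of_ringEquiv (Ideal.quotEquivOfEq hQy.symm), hr]
  -- `H_X(x) = H_X(y)`
  have hxy : Scheme.hsFun X N x = Scheme.hsFun X N y :=
    (Scheme.hsFun_eq_iff_of_specializes_of_isRegularLocalRing N hyx hcat hc hN).mpr (by rw [hHS, heq])
  -- so `y ∈ X_max ∩ U = {x}`
  have hy : y ∈ Scheme.hsMaxLocus X N := mem_hsMaxLocus_of_hsFun_eq hx hxy.symm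
  have hyU : y ∈ U := hyx.mem_open hU hxU
  have hyx' : y = x := by
    have : y ∈ U ∩ Scheme.hsMaxLocus X N := ⟨hyU, hy⟩
    rw [hUx] at this
    exact this
  exact hne (hQy ▸ primeOfSpecializes_eq_maximalIdeal_of_eq hyx hyx')

end Summit.ResolutionOfSingularities.ResolutionOfSingularities.Cruxes.SigmaMaxModifications.IdeasL1C5

end
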